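import Summits.ResolutionOfSingularities.ResolutionOfSingularities.Theorems.DeltaCutStellarLowLaw
import Summits.ResolutionOfSingularities.ResolutionOfSingularities.Theorems.DeltaCutStellarNR

/-!
# StellarCut N23d — «NonResonantLaw»: the frame class `IsNCHypStageNR`, the cell `WORNCHypWildNR n` DECIDED · HOLDS at every level,
# the exact carve `WORNCHypWildRest5 n ⟺ WORNCHypWildNR n ∧ WORNCHypWildRest6 n`, and the column's carve re-wired
# (lens-6 «barrier-complement carving», g37 door 4)

Route `MaxContactCut`, column `E1TopNoAbs` (item 26971); decomposition lineage `decomp-res-lens-6`.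

THE LOCATED RESIDUAL BEFORE THIS FILE (R22b): `E1TopNoAbs ⟸ … ⟸ E1NCHypWildRest5 = ∀ n ≥ 1, WORNCHypWildRest5 n`, UNDECIDED, typed
with the test families (iii-a) `h⁴ + u·z⁴` (char `2`, composite-marking kangaroo), (iii-b) residue `≥ p` (g34's `(3, 3)` at `n = 4`),
(i-b) «EvenLatent», (ii) «polynomial tail».

THIS FILE carves family (iii-b) — and every NON-RESONANT labelled frame, at every marking, in every characteristic — OUT of it:
* §Class — `IsNCHypStageNR n N`: an s.n.c. frame in the hypersurface shape with `SuppLE` every label `a` of which satisfies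
  `a = 0 ∨ a % n ≠ 0` (NO prime in the condition); `isNCHypStageNR_of_low` (R22b ⊆), `isNCHypStageNR_of_cop` (T18 ⊆ at `p ∣ n`),
  `isNCHypStageNR_self_iff_cop` (at `n = p` it IS T18's class);
* §Cells — `WORNCHypWildNR n` (binders of `WORNCHypWildRest5 n` VERBATIM + `IsNCHypStageNR n`), the remainder `WORNCHypWildRest6 n`
  (+ `¬ IsNCHypStageNR n`), ★ the carve `worNCHypWildRest5_iff_nr_rest6` (exact, hyp-free, excluded middle), families;
* §Law — the bridge `exists_ncHypShapeNR_of_isNCHypStageNR` (characteristic-FREE), ★★ `worNR_holds` (over ANY field),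
  ★★ `worNCHypWildNR_holds (n) (hn : 1 ≤ n) : WORNCHypWildNR n` — N23c's list law on the exact-face round lemma (N23b) and the
  higher-order Hasse guard (N23a); the residual re-wired: `worNCHypWildRest5_iff_rest6`, `worNCHypWild_iff_rest6`,
  `e1NCHypWild_iff_rest6`, `e1NCHyp_of_wildRest6`;
* §Carve — `e1TopSHeavy_of_wildRest6_offNC`, `e1TopNoAbs_of_wildRest6`, `e1TopGHeavy_of_wildRest6`.

THE NEW LOCATED RESIDUAL `E1NCHypWildRest6` — UNDECIDED · typed with test data: (iii-a′) RESONANT labels — a positive label that is a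
MULTIPLE of the marking (`h⁴ + u·z⁴`, `h⁶ + u·z⁶w⁶`; char `p ∣ n`): the exact guard genuinely fails (`T_h⁴ + T_z⁴ = (T_h + T_z)⁴`
has order `4` at `T_h = T_z`) — IDEA-NEEDED (a weighted / residual-order invariant); (i-b) «EvenLatent» (`p = n = 2`, latent
non-monomial face equation); (ii) «polynomial tail» (`p = n`, `zᵖ + (unit)·wᵖ + (higher)`). Kernel-inhabited cell: N23e.

0 sorry; axioms standard. [new] [cite: Kollar2007, (3.111) Step 3] [cite: EGAIV4, Thm. 16.11.2] [cite: CossartPiltant2008, Prop. 4.2 (a)]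
[cite: Hauser2010, §§3–5]
-/

noncomputable section

open CategoryTheory CategoryTheory.Limits AlgebraicGeometry TopologicalSpace IsLocalRing
open Literature.AlgebraicGeometry.Resolution

namespace Summit.ResolutionOfSingularities.ResolutionOfSingularities.Theorems.DeltaCutClasses

open Summit.ResolutionOfSingularities.ResolutionOfSingularities.Theorems
open WeakOrderReduction ForcedTowerClasses

/-! ### §Class — the non-resonant frame class -/

section Class

/-- **`IsNCHypStageNR n N` — NON-RESONANT LABELLED hypersurface-shape n.c. stage**: an s.n.c. frame in the hypersurface shape with
`SuppLE` (i.e. `IsNCHypStage n N`, T1) every label `a` of which satisfies `a = 0 ∨ a % n ≠ 0` — no positive label is a multiple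
of the marking.  NO prime in the condition.  DEFINITION (letter · the «NonResonant» class; meaningful at every marking). [new] -/
def IsNCHypStageNR (n : ℕ) (N : Stage) : Prop :=
  ∃ F : NCFrame N, F.IsSNC ∧ F.HypShape n ∧ F.SuppLE n ∧ ∀ i, F.a i = 0 ∨ F.a i % n ≠ 0

/-- a non-resonant stage is a hypersurface-shape n.c. stage -/
theorem isNCHypStage_of_nr {n : ℕ} {N : Stage} (h : IsNCHypStageNR n N) : IsNCHypStage n N := by
  obtain ⟨F, hS, hF, hSupp, -⟩ := h
  exact ⟨F, hS, hF, hSupp⟩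

/-- **R22b's low-residue stages are non-resonant** (`0 < a % n ⇒ a % n ≠ 0`; the prime plays no role). [new] -/
theorem isNCHypStageNR_of_low {p n : ℕ} {N : Stage} (h : IsNCHypStageLow p n N) : IsNCHypStageNR n N := by
  obtain ⟨F, hS, hF, hSupp, hlab⟩ := h
  exact ⟨F, hS, hF, hSupp, fun i => (hlab i).imp_right fun h => Nat.pos_iff_ne_zero.mp h.1⟩

/-- **T18's coprime stages are non-resonant at every marking `p ∣ n`** (`p ∤ a ⇒ n ∤ a`). [new] -/
theorem isNCHypStageNR_of_cop {p n : ℕ} (hpn : p ∣ n) {N : Stage} (h : IsNCHypStageCop p n N) : IsNCHypStageNR n N := by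
  obtain ⟨F, hS, hF, hSupp, hlab⟩ := h
  exact ⟨F, hS, hF, hSupp, fun i => (hlab i).imp_right fun hnd hmod => hnd (dvd_trans hpn (Nat.dvd_of_mod_eq_zero hmod))⟩

/-- at the pure marking `n = p` a non-resonant stage is a coprime stage (T18). [new] -/
theorem isNCHypStageCop_of_nr_self {p : ℕ} {N : Stage} (h : IsNCHypStageNR p N) : IsNCHypStageCop p p N := by
  obtain ⟨F, hS, hF, hSupp, hlab⟩ := h
  exact ⟨F, hS, hF, hSupp, fun i => (hlab i).imp_right fun h hdvd => h (Nat.mod_eq_zero_of_dvd hdvd)⟩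

/-- ★ **AT `n = p` THE NON-RESONANT CLASS IS T18's COPRIME CLASS** (no primality needed). [new] -/
theorem isNCHypStageNR_self_iff_cop {p : ℕ} {N : Stage} : IsNCHypStageNR p N ↔ IsNCHypStageCop p p N :=
  ⟨isNCHypStageCop_of_nr_self, isNCHypStageNR_of_cop (dvd_refl p)⟩

/-- at the pure marking a non-resonant stage is a JET stage (T18 ⊆ T19: `isNCHypStageJet_of_cop`). [new] -/
theorem isNCHypStageJet_of_nr_self {p : ℕ} {N : Stage} (h : IsNCHypStageNR p N) : IsNCHypStageJet p p N :=
  isNCHypStageJet_of_cop (isNCHypStageCop_of_nr_self h)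

end Class

/-! ### §Cells — the non-resonant cell, the new remainder, the exact carve -/

section Cells

/-- **`WORNCHypWildNR n` — THE NON-RESONANT CELL**: the binders of `WORNCHypWildRest5 n` (R22b) VERBATIM, PLUS a non-resonant frame
(`IsNCHypStageNR n`; NO `p = n` guard, no prime in the class).  DECIDED · HOLDS (`worNCHypWildNR_holds`).  At the prime levels it is
subsumed by the jet binder (`worNCHypWildNR_of_prime`), its low-residue part by R22b's cell; its content is the composite markings
with labels of residue `≥ p` — EVERY tight face `p`-divisible.  Kernel-inhabited (N23e): `x₀⁴ + x₁³x₂³` over `𝔽₂` at marking `4`,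
frame `(V(x₀); x₁ : 3, x₂ : 3)` — g34's witness. [new] [cite: Kollar2007, (3.111) Step 3] [cite: EGAIV4, Thm. 16.11.2] -/
def WORNCHypWildNR (n : ℕ) : Prop :=
  ∀ p : ℕ, p.Prime → ∀ (k : Type) [Field k] [CharP k p] (Y : Scheme.{0}) (g : Y ⟶ Spec (.of k)),
    IsBase Y g → p ∣ n → ∀ M : MarkedIdeal Y, IsDatum n M → IsNCHypStage n ⟨Y, M.ideal⟩ →
      ¬ (p = n ∧ IsNCHypStageJet p n ⟨Y, M.ideal⟩) → ¬ (p = n ∧ IsNCHypStageLat p ⟨Y, M.ideal⟩) →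
        ¬ (p = n ∧ IsNCHypStageLatJ p ⟨Y, M.ideal⟩) → ¬ IsNCHypStageLow p n ⟨Y, M.ideal⟩ → IsNCHypStageNR n ⟨Y, M.ideal⟩ →
          ∃ t : CentreSeq Y, WeakResolution t M

/-- **`WORNCHypWildRest6 n` — THE REMAINDER AFTER THE NON-RESONANT CELL**: the binders of `WORNCHypWildRest5 n` verbatim PLUS
`¬ IsNCHypStageNR n`.  UNDECIDED · TYPED WITH TEST DATA (module docstring): (iii-a′) RESONANT labels — a positive label that is a
multiple of `n` (`h⁴ + u·z⁴`, char `2`; the exact guard genuinely fails) — IDEA-NEEDED; (i-b) «EvenLatent», (ii) «polynomial tail»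
at `p = n`. [new] [cite: Hauser2010, §§3–5] -/
def WORNCHypWildRest6 (n : ℕ) : Prop :=
  ∀ p : ℕ, p.Prime → ∀ (k : Type) [Field k] [CharP k p] (Y : Scheme.{0}) (g : Y ⟶ Spec (.of k)),
    IsBase Y g → p ∣ n → ∀ M : MarkedIdeal Y, IsDatum n M → IsNCHypStage n ⟨Y, M.ideal⟩ →
      ¬ (p = n ∧ IsNCHypStageJet p n ⟨Y, M.ideal⟩) → ¬ (p = n ∧ IsNCHypStageLat p ⟨Y, M.ideal⟩) →
        ¬ (p = n ∧ IsNCHypStageLatJ p ⟨Y, M.ideal⟩) → ¬ IsNCHypStageLow p n ⟨Y, M.ideal⟩ → ¬ IsNCHypStageNR n ⟨Y, M.ideal⟩ →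
          ∃ t : CentreSeq Y, WeakResolution t M

/-- ★ **THE CARVE OF THE REMAINDER BY THE NON-RESONANT CLASS (exact, hyp-free, pure logic)**:
`WORNCHypWildRest5 n ⟺ WORNCHypWildNR n ∧ WORNCHypWildRest6 n`. [new] -/
theorem worNCHypWildRest5_iff_nr_rest6 (n : ℕ) : WORNCHypWildRest5 n ↔ WORNCHypWildNR n ∧ WORNCHypWildRest6 n := by
  constructor
  · intro h
    exact ⟨fun p hp k _ _ Y g hB hd M hM hS hc hl hj hw _ => h p hp k Y g hB hd M hM hS hc hl hj hw,
      fun p hp k _ _ Y g hB hd M hM hS hc hl hj hw _ => h p hp k Y g hB hd M hM hS hc hl hj hw⟩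
  · rintro ⟨hL, hR⟩ p hp k _ _ Y g hB hd M hM hS hc hl hj hw
    by_cases hnr : IsNCHypStageNR n ⟨Y, M.ideal⟩
    · exact hL p hp k Y g hB hd M hM hS hc hl hj hw hnr
    · exact hR p hp k Y g hB hd M hM hS hc hl hj hw hnr

/-- the FAMILY of non-resonant cells (all markings `n ≥ 1`) -/
def E1NCHypWildNR : Prop := ∀ n : ℕ, 1 ≤ n → WORNCHypWildNR n

/-- the FAMILY of new remainders (all markings `n ≥ 1`): the column's LOCATED RESIDUAL after g37 door 4. UNDECIDED · typed with test data. -/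
def E1NCHypWildRest6 : Prop := ∀ n : ℕ, 1 ≤ n → WORNCHypWildRest6 n

/-- families: `E1NCHypWildRest5 ⟺ E1NCHypWildNR ∧ E1NCHypWildRest6` (exact, pure logic). [new] -/
theorem e1NCHypWildRest5_iff_nr_rest6 : E1NCHypWildRest5 ↔ E1NCHypWildNR ∧ E1NCHypWildRest6 :=
  ⟨fun h => ⟨fun n hn => ((worNCHypWildRest5_iff_nr_rest6 n).mp (h n hn)).1,
    fun n hn => ((worNCHypWildRest5_iff_nr_rest6 n).mp (h n hn)).2⟩,
    fun h n hn => (worNCHypWildRest5_iff_nr_rest6 n).mpr ⟨h.1 n hn, h.2 n hn⟩⟩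

end Cells

/-! ### §Law — the bridge from the binders and the non-resonant law -/

section Law

open AlgebraicGeometry.Scheme.IdealSheafData (vanishingIdeal)

variable {Y : Scheme.{0}}

/-- **THE BRIDGE from the binders of `WORNCHypWildNR`, CHARACTERISTIC-FREE**: a base `n`-datum (`n ≠ 0`) over ANY field whose stage is
a NON-RESONANT hypersurface-shape n.c. stage is a `ncHypShapeNR n`-datum for `E := (𝓘(H), 0) :: [(𝓘(Dᵢ), aᵢ)]ᵢ`, `H := 𝓘(F.H)`
(T17b's unit-free bridge; the exponents of `E` are the labels). [new] [folklore] -/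
theorem exists_ncHypShapeNR_of_isNCHypStageNR {n : ℕ} (hn : n ≠ 0) {k : Type} [Field k] (g : Y ⟶ Spec (.of k)) (hB : IsBase Y g)
    {M : MarkedIdeal Y} (hM : IsDatum n M) (hNC : IsNCHypStageNR n ⟨Y, M.ideal⟩) :
    ∃ (E : List (Y.IdealSheafData × ℕ)) (H : Y.IdealSheafData),
      HasSNC (H :: boundaryOf E) ∧ H ∈ boundaryOf E ∧ ncHypShapeNR n Y E H M := by
  obtain ⟨F, hS, hF, hSupp, hlab⟩ := hNC
  obtain ⟨hH, hEs, hP⟩ := ncHypShapeF_of_isBase g hB hM hS hF hSupp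
  have hinj : ∀ i j, vanishingIdeal (F.D i) = vanishingIdeal (F.D j) → i = j := by
    intro i j hij
    by_contra hne
    have hset : ((F.D i : Closeds Y) : Set Y) = (F.D j : Set Y) := by
      rw [← Scheme.IdealSheafData.coe_support_vanishingIdeal (Z := F.D i), hij,
        Scheme.IdealSheafData.coe_support_vanishingIdeal]
    exact hS.2.2.2.2.2 i j hne hset.le
  refine ⟨_, _, hEs, hH, hP, hn, fun K y _ => ?_⟩
  rcases F.expOf_cons_expList hinj K with h0 | ⟨i, hi⟩
  · exact Or.inl h0
  · rw [hi]; exact hlab i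

/-- ★★ **THE NON-RESONANT LAW, frame level, hyp-free, OVER ANY FIELD**: a base `n`-datum (`n ≥ 1`) whose stage is a NON-RESONANT
n.c. stage admits a weak resolution — Kollár's strategy through `H` (T16) on N23c's star-stable class, every round certified by the
higher-order Hasse guard (N23a/N23b).  No prime, no characteristic hypothesis. [new] [cite: Kollar2007, (3.111) Step 3]
[cite: EGAIV4, Thm. 16.11.2] [cite: CossartPiltant2008, Prop. 4.2 (a)] -/
theorem worNR_holds {n : ℕ} (hn : 1 ≤ n) {k : Type} [Field k] (g : Y ⟶ Spec (.of k)) (hB : IsBase Y g) (M : MarkedIdeal Y)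
    (hM : IsDatum n M) (hNC : IsNCHypStageNR n ⟨Y, M.ideal⟩) : ∃ t : CentreSeq Y, WeakResolution t M := by
  haveI := hB.locallyOfFiniteType
  haveI := hB.quasiCompact
  haveI : IsLocallyNoetherian Y := LocallyOfFiniteType.isLocallyNoetherian g
  obtain ⟨E, H, hEs, hH, hP⟩ := exists_ncHypShapeNR_of_isNCHypStageNR (by omega) g hB hM hNC
  exact hP.exists_weakResolution hEs hH

/-- ★★ **THE NON-RESONANT CELL IS DECIDED · HOLDS** — `WORNCHypWildNR n` for every `n ≥ 1`: over a field of characteristic `p ∣ n`, a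
base `n`-datum whose stage is a NON-RESONANT labelled s.n.c. hypersurface-shape stage admits a weak resolution — every face is EXACT
(N23c), the exact-face round lemma (N23b: near-point bound with `e := n` + the higher-order Hasse guard of N23a) transforms the shape,
and the new label stays non-resonant along Kollár's star phases at EVERY marking (N23c `nr_weightOf_sub_of_starBelowH`).  The FIRST
decided cell whose tight faces are ALL `p`-divisible; the cell `WORNCHypWildNR` of the carving `worNCHypWildRest5_iff_nr_rest6` is
DECIDED · HOLDS; `WORNCHypWildRest6` stays UNDECIDED. [new] [cite: Kollar2007, (3.111) Step 3] [cite: EGAIV4, Thm. 16.11.2] -/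
theorem worNCHypWildNR_holds (n : ℕ) (hn : 1 ≤ n) : WORNCHypWildNR n :=
  fun _ _ _ _ _ _ g hB _ M hM _ _ _ _ _ hNC => worNR_holds hn g hB M hM hNC

/-- the FAMILY of non-resonant cells holds. [new] -/
theorem e1NCHypWildNR_holds : E1NCHypWildNR := worNCHypWildNR_holds

-- the law, fully qualified, binders `n` / `1 ≤ n` only (critic (x2)).
example (n : ℕ) (hn : 1 ≤ n) :
    Summit.ResolutionOfSingularities.ResolutionOfSingularities.Theorems.DeltaCutClasses.WORNCHypWildNR n :=
  worNCHypWildNR_holds n hn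

/-- **at a PRIME level the non-resonant cell carries no content**: `p ∣ n` with `n` prime forces `p = n`, the non-resonant stage is
then a coprime stage, hence a jet stage (§Class), which the jet binder excludes. [new] -/
theorem worNCHypWildNR_of_prime {n : ℕ} (hn : n.Prime) : WORNCHypWildNR n := by
  intro p hp _ _ _ _ _ _ hpn _ _ _ hJ _ _ _ hNC
  obtain rfl : p = n := (Nat.prime_dvd_prime_iff_eq hp hn).mp hpn
  exact absurd ⟨rfl, isNCHypStageJet_of_nr_self hNC⟩ hJ

/-- ★ **THE REMAINDER IS ITS NEW REMAINDER (exact, `n ≥ 1`)**: `WORNCHypWildRest5 n ⟺ WORNCHypWildRest6 n`. [new] -/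
theorem worNCHypWildRest5_iff_rest6 {n : ℕ} (hn : 1 ≤ n) : WORNCHypWildRest5 n ↔ WORNCHypWildRest6 n := by
  rw [worNCHypWildRest5_iff_nr_rest6]
  exact ⟨fun h => h.2, fun h => ⟨worNCHypWildNR_holds n hn, h⟩⟩

/-- ★ per level (`n ≥ 1`), the wild cell reduces to the new remainder: `WORNCHypWild n ⟺ WORNCHypWildRest6 n` (exact). [new] -/
theorem worNCHypWild_iff_rest6 {n : ℕ} (hn : 1 ≤ n) : WORNCHypWild n ↔ WORNCHypWildRest6 n :=
  (worNCHypWild_iff_rest5 hn).trans (worNCHypWildRest5_iff_rest6 hn)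

/-- per level: `WORNCHypWildRest6 n → WORNCHyp n` (`n ≥ 1`). [new] -/
theorem worNCHyp_of_wildRest6 {n : ℕ} (hn : 1 ≤ n) (hR : WORNCHypWildRest6 n) : WORNCHyp n :=
  worNCHyp_of_wildRest5 hn ((worNCHypWildRest5_iff_rest6 hn).mpr hR)

/-- families: `E1NCHypWildRest5 ⟺ E1NCHypWildRest6` (exact, hyp-free). [new] -/
theorem e1NCHypWildRest5_iff_rest6 : E1NCHypWildRest5 ↔ E1NCHypWildRest6 :=
  ⟨fun h n hn => (worNCHypWildRest5_iff_rest6 hn).mp (h n hn), fun h n hn => (worNCHypWildRest5_iff_rest6 hn).mpr (h n hn)⟩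

/-- families: `E1NCHypWild ⟺ E1NCHypWildRest6` (exact, hyp-free). [new] -/
theorem e1NCHypWild_iff_rest6 : E1NCHypWild ↔ E1NCHypWildRest6 := e1NCHypWild_iff_rest5.trans e1NCHypWildRest5_iff_rest6

/-- families: `E1NCHypWildRest6 → E1NCHyp`. [new] -/
theorem e1NCHyp_of_wildRest6 (hR : E1NCHypWildRest6) : E1NCHyp := e1NCHyp_of_wildRest5 (e1NCHypWildRest5_iff_rest6.mpr hR)

end Law

/-! ### §Carve — the column's carve with the non-resonant cell DISCHARGED -/

section Carve

open SubfieldContactClasses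

/-- exact remainder form: `E1NCHypWildRest6 → E1TopSHeavyOffNC → E1TopSHeavy`. [new] -/
theorem e1TopSHeavy_of_wildRest6_offNC (hR : E1NCHypWildRest6) (hO : E1TopSHeavyOffNC) : E1TopSHeavy :=
  e1TopSHeavy_of_wildRest5_offNC (e1NCHypWildRest5_iff_rest6.mpr hR) hO

/-- edge to the column item (26971): under `SubfieldContactAbs` and `E 5`,
`E1NCHypWildRest6 → E1NCEntryPerpetual → E1TopSFrozenOffNC → E1TopNoAbs`. [new] -/
theorem e1TopNoAbs_of_wildRest6 (hSC : SubfieldContactAbs) (h5 : E 5) (hR : E1NCHypWildRest6) (hE : E1NCEntryPerpetual)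
    (hO : E1TopSFrozenOffNC) : E1TopNoAbs :=
  e1TopNoAbs_of_wildRest5 hSC h5 (e1NCHypWildRest5_iff_rest6.mpr hR) hE hO

/-- edge to the live aside (item 27045): under `E 5`,
`E1NCHypWildRest6 → E1NCEntryPerpetual → E1TopSFrozenOffNC → E1TopGHeavy`. [new] -/
theorem e1TopGHeavy_of_wildRest6 (h5 : E 5) (hR : E1NCHypWildRest6) (hE : E1NCEntryPerpetual) (hO : E1TopSFrozenOffNC) :
    E1TopGHeavy :=
  e1TopGHeavy_of_wildRest5 h5 (e1NCHypWildRest5_iff_rest6.mpr hR) hE hO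

end Carve

end Summit.ResolutionOfSingularities.ResolutionOfSingularities.Theorems.DeltaCutClasses
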